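import Literature.Probability.RandomPlanarGeometry.HexSAWPolygonCells
import HarnessLib

/-!
# Cell calculus for honeycomb polygon surgery, IV: RAYS — re-growing a stick of spikes from a port costs exactly `4` per hexagon

Topic `Literature/Probability/RandomPlanarGeometry` (lane «pcv-sawmu», a-p4 g21; sequel of `HexSAWPolygonCells.lean`).

In the closed form `ι(S) = C(B) ⊔ ⨆_h ray(port_B h, ℓ_h)` of the step-two injection «OMEGA» (`HOME/pub-sawmu-a-p4/g21/omega/
THEOREM-OMEGA-g21.md` §4) every removed stick of up-right spikes of length `ℓ` is re-grown as the RAY `{p, UR p, …, UR^{ℓ−1} p}` from the port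
`p` of its host.  THEOREM V there needs: if `p` is a clean leaf spot of the image `C` whose contact is below it (`UL p, R p ∉ C`) and `UR p`
lies lexicographically above every hexagon of `C`, then the whole ray can be grown, each hexagon having exactly one contact when it is added,
so that `perim (C ∪ ray p ℓ) = perim C + 4ℓ`.  This file proves exactly that (`perim_union_ray`), by induction on `ℓ` with the contact
computation `card_contacts_rayCell_succ` (the hexagon `UR^{i+1} p` touches only `UR^i p`).

Sources: N. Madras, G. Slade, *The Self-Avoiding Walk* (1993), §3.2, proof of Theorem 3.2.3 [MadrasSlade1993]; I. Jensen, J. Phys.: Conf.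
Ser. 42 (2006) 163 [Jensen2006HoneycombPolygons].  Label (lane): LANE INFRASTRUCTURE; nothing new in writing.
-/

open Finset

namespace Literature.Probability.RandomPlanarGeometry.SAW

namespace HexCell

/-- The `i`-th hexagon of the ray from `p`: `UR^i p = (p.x + i, p.y + i)`. [cite: MadrasSlade1993, §3.2 (proof of Theorem 3.2.3)] -/
def rayCell (p : Cell) (i : ℕ) : Cell := (p.1 + (i : ℤ), p.2 + (i : ℤ))

/-- The abscissa of `rayCell p i`. [cite: MadrasSlade1993, §3.2 (proof of Theorem 3.2.3)] -/
@[simp] theorem rayCell_fst (p : Cell) (i : ℕ) : (rayCell p i).1 = p.1 + (i : ℤ) := rfl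
/-- The row of `rayCell p i`. [cite: MadrasSlade1993, §3.2 (proof of Theorem 3.2.3)] -/
@[simp] theorem rayCell_snd (p : Cell) (i : ℕ) : (rayCell p i).2 = p.2 + (i : ℤ) := rfl

/-- The ray of length `ℓ` from `p`: `{p, UR p, …, UR^{ℓ−1} p}`. [cite: MadrasSlade1993, §3.2 (proof of Theorem 3.2.3)] -/
def ray (p : Cell) (ℓ : ℕ) : Finset Cell := (range ℓ).image (rayCell p)

/-- `rayCell p` is injective. [cite: MadrasSlade1993, §3.2 (proof of Theorem 3.2.3)] -/
theorem rayCell_injective (p : Cell) : Function.Injective (rayCell p) := by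
  intro i j h
  have := congrArg Prod.fst h
  simp only [rayCell_fst] at this
  omega

/-- Membership in a ray. [cite: MadrasSlade1993, §3.2 (proof of Theorem 3.2.3)] -/
theorem mem_ray {p : Cell} {ℓ : ℕ} {c : Cell} : c ∈ ray p ℓ ↔ ∃ i < ℓ, rayCell p i = c := by simp [ray]

/-- A ray of length `ℓ` has `ℓ` hexagons. [cite: MadrasSlade1993, §3.2 (proof of Theorem 3.2.3)] -/
theorem card_ray (p : Cell) (ℓ : ℕ) : #(ray p ℓ) = ℓ := by
  rw [ray, card_image_of_injective _ (rayCell_injective p), card_range]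

/-- `ray p (ℓ+1) = insert (UR^ℓ p) (ray p ℓ)`. [cite: MadrasSlade1993, §3.2 (proof of Theorem 3.2.3)] -/
theorem ray_succ (p : Cell) (ℓ : ℕ) : ray p (ℓ + 1) = insert (rayCell p ℓ) (ray p ℓ) := by
  rw [ray, ray, range_add_one, image_insert]

/-- `UR^ℓ p` is not among the first `ℓ` ray hexagons. [cite: MadrasSlade1993, §3.2 (proof of Theorem 3.2.3)] -/
theorem rayCell_notMem_ray (p : Cell) (ℓ : ℕ) : rayCell p ℓ ∉ ray p ℓ := by
  intro h
  obtain ⟨i, hi, e⟩ := mem_ray.1 h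
  have := rayCell_injective p e
  omega

/-- A hexagon of the ray lies on the diagonal of `p`, at height `≥ p.y`. [cite: MadrasSlade1993, §3.2 (proof of Theorem 3.2.3)] -/
theorem mem_ray_iff_coords {p : Cell} {ℓ : ℕ} {x y : ℤ} :
    ((x, y) : Cell) ∈ ray p ℓ ↔ x - p.1 = y - p.2 ∧ p.2 ≤ y ∧ y < p.2 + ℓ := by
  rw [mem_ray]
  constructor
  · rintro ⟨i, hi, e⟩
    have h1 := congrArg Prod.fst e; have h2 := congrArg Prod.snd e
    simp only [rayCell_fst, rayCell_snd] at h1 h2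
    omega
  · rintro ⟨h1, h2, h3⟩
    refine ⟨(y - p.2).toNat, by omega, ?_⟩
    ext <;> simp <;> omega

/-- The «ABOVE» condition: `UR p` is lexicographically above every hexagon of `C`. [cite: MadrasSlade1993, §3.2 (proof of Theorem 3.2.3)] -/
def RayClear (C : Finset Cell) (p : Cell) : Prop := ∀ c ∈ C, c.2 < p.2 + 1 ∨ (c.2 = p.2 + 1 ∧ c.1 < p.1 + 1)

/-- **Contacts of the next ray hexagon**: if `UL p, R p ∉ C` and `UR p` is above `C`, then for every `i` the hexagon `UR^{i+1} p` has, in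
`C ∪ ray p (i+1)`, the single contact `UR^i p`. [cite: MadrasSlade1993, §3.2 (proof of Theorem 3.2.3: re-attaching the removed squares)] -/
theorem card_contacts_rayCell_succ {C : Finset Cell} {p : Cell} (hUL : UL p ∉ C) (hR : R p ∉ C) (hclear : RayClear C p) (i : ℕ) :
    rayCell p (i + 1) ∉ C ∪ ray p (i + 1) ∧ #(nbrs (rayCell p (i + 1)) ∩ (C ∪ ray p (i + 1))) = 1 := by
  obtain ⟨a, b⟩ := p
  -- a cell of `C` has row `≤ b + 1`, and on row `b + 1` abscissa `≤ a`
  have hC : ∀ x y : ℤ, ((x, y) : Cell) ∈ C → y ≤ b + 1 ∧ (y = b + 1 → x ≤ a) := by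
    intro x y h
    rcases hclear _ h with h1 | ⟨h1, h2⟩
    · dsimp only at h1; omega
    · dsimp only at h1 h2; omega
  have hnot : ∀ x y : ℤ, (b + 1 < y ∨ (y = b + 1 ∧ a < x)) → ¬ (x - a = y - b ∧ b ≤ y ∧ y < b + (i + 1 : ℕ)) →
      ((x, y) : Cell) ∉ C ∪ ray (a, b) (i + 1) := by
    intro x y h1 h2 hm
    rcases mem_union.1 hm with hm | hm
    · have := hC x y hm; omega
    · exact h2 (mem_ray_iff_coords.1 hm)
  refine ⟨hnot _ _ (by simp; omega) (by simp), ?_⟩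
  have e : nbrs (rayCell (a, b) (i + 1)) ∩ (C ∪ ray (a, b) (i + 1)) = {rayCell (a, b) i} := by
    ext c
    simp only [mem_inter, mem_nbrs_iff, rayCell_fst, rayCell_snd, mem_singleton]
    constructor
    · rintro ⟨hc, hcS⟩
      rcases hc with rfl | rfl | rfl | rfl | rfl | rfl
      · ext <;> simp <;> ring
      · -- LR = (a+i+2, b+i): for i = 0 this is `R p`; else above/right of `C`; never a ray cell
        exfalso
        rcases Nat.eq_zero_or_pos i with rfl | hi
        · rcases mem_union.1 hcS with h | h
          · apply hR; convert h using 1; ext <;> simp; ring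
          · have := mem_ray_iff_coords.1 h; simp at this; omega
        · exact hnot _ _ (by push_cast; omega) (by push_cast; omega) hcS
      · exact absurd hcS (hnot _ _ (by push_cast; omega) (by push_cast; omega))
      · exact absurd hcS (hnot _ _ (by push_cast; omega) (by push_cast; omega))
      · exact absurd hcS (hnot _ _ (by push_cast; omega) (by push_cast; omega))
      · -- L = (a+i−1, b+i+1): for i = 0 this is `UL p`; else above `C`; never a ray cell
        exfalso
        rcases Nat.eq_zero_or_pos i with rfl | hi
        · rcases mem_union.1 hcS with h | h
          · apply hUL; convert h using 1; ext <;> simp; ring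
          · have := mem_ray_iff_coords.1 h; simp at this
        · exact hnot _ _ (by push_cast; omega) (by push_cast; omega) hcS
    · rintro rfl
      refine ⟨Or.inl (by ext <;> simp <;> ring), mem_union_right _ (mem_ray.2 ⟨i, by omega, rfl⟩)⟩
  rw [e, card_singleton]

/-- **Growing a ray costs `4` per hexagon**: if `p ∉ C` is a clean leaf spot (one contact) with `UL p, R p ∉ C` and `UR p` above `C`, then
`perim (C ∪ ray p ℓ) = perim C + 4ℓ`. [cite: MadrasSlade1993, §3.2, Theorem 3.2.3 proof (length bookkeeping), transplanted to `ℍ`] -/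
theorem perim_union_ray {C : Finset Cell} {p : Cell} (hp : p ∉ C) (h1 : #(nbrs p ∩ C) = 1) (hUL : UL p ∉ C) (hR : R p ∉ C)
    (hclear : RayClear C p) (ℓ : ℕ) : perim (C ∪ ray p ℓ) = perim C + 4 * ℓ := by
  classical
  induction ℓ with
  | zero => simp [ray]
  | succ i ih =>
    rw [ray_succ, union_insert]
    rcases Nat.eq_zero_or_pos i with rfl | hi
    · -- the port itself
      have e0 : rayCell p 0 = p := by ext <;> simp
      rw [e0]
      have : C ∪ ray p 0 = C := by simp [ray]
      rw [this, perim_insert_of_contacts_eq_one hp h1]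
    · obtain ⟨j, rfl⟩ : ∃ j, i = j + 1 := ⟨i - 1, by omega⟩
      obtain ⟨hnot, hc⟩ := card_contacts_rayCell_succ hUL hR hclear j
      rw [perim_insert_of_contacts_eq_one hnot hc, ih]
      ring

/-- The rayed set has `#C + ℓ` hexagons (the ray avoids `C`). [cite: MadrasSlade1993, §3.2 (proof of Theorem 3.2.3)] -/
theorem card_union_ray {C : Finset Cell} {p : Cell} (hp : p ∉ C) (hclear : RayClear C p) (ℓ : ℕ) :
    #(C ∪ ray p ℓ) = #C + ℓ := by
  rw [card_union_of_disjoint, card_ray]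
  rw [disjoint_iff_ne]
  rintro c hc _ hd rfl
  obtain ⟨i, hi, rfl⟩ := mem_ray.1 hd
  rcases Nat.eq_zero_or_pos i with rfl | hi'
  · exact hp (by convert hc using 1; ext <;> simp)
  · rcases hclear _ hc with h | ⟨h, h'⟩
    · simp at h; omega
    · simp at h h'; omega

end HexCell

end Literature.Probability.RandomPlanarGeometry.SAW
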